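import Literature.Geometry.Lorentzian.CoordTensorRicciIdentity
import Literature.Geometry.Lorentzian.CoordCurvatureNormSq
import Mathlib.Algebra.Order.Chebyshev
import HarnessLib

/-!
# Norms of covariant tensor fields in coordinates: orthonormal frames and bounds

Third layer of the rank-generic coordinate tensor calculus (`CoordTensorCalculus.lean`,
`CoordTensorRicciIdentity.lean`), towards Shi's derivative estimates (Topping 2006, Thm. 3.3.1):
the pointwise norm `|T|²_g = tnormSq G b T x` read in a `G x`-orthonormal frame `e`
(`exists_orthonormal_basis`, `CoordCurvatureNormSq.lean`), for positive definite `G x`.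

* `frameComp b T₀ v = Σ_I (Π_a bᴵᵃ(v a)) T₀ I` — the multilinear evaluation of a component array
  `T₀ : (α → ι) → ℝ` on vectors `v : α → E` (so `frameComp b T₀ (b ∘ I) = T₀ I`);
* `ginv_eq_sum_coord_frame` — `g^{ij} = Σ_c bⁱ(e_c) bʲ(e_c)`;
* **`tinner_eq_sum_frame` / `tnormSq_eq_sum_sq_frame` (Parseval)** — `⟨S,T⟩ = Σ_K S(e_K) T(e_K)`,
  `|T|² = Σ_K T(e_K)²`; hence `tnormSq_nonneg`, `abs_frameComp_le_sqrt` (`|T(e_K)| ≤ |T|`),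
  **`abs_tinner_le` (Cauchy–Schwarz `|⟨S,T⟩| ≤ |S| |T|`)**, `tnormSq_add_le`;
* **`tnormSq_ttr_le`** — `|tr T|² ≤ n |T|²` (`n = dim E`);
* **`abs_apply_le_sqrt_prod_mul`** — coordinate components against the norm:
  `|T_I| ≤ (Π_a g_{I_a I_a})^{1/2} |T|`;
* `tnormSq_rm4_eq_rmNormSqAt` — for the curvature tensor, `|Rm|²` of this file is the `|Rm|²`
  of `CoordCurvatureNormSq.lean` (`rmNormSqAt`), through the multilinear expansion
  `frameComp b (rm4 G b x) v = G(R(v₀,v₁)v₂, v₃)`.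

These are Topping's conventions (2006, §2.1 and p. 37: `|Rm|` in an orthonormal frame dominates
every component); O'Neill 1983, Ch. 2, Lemma 2.25 ff. (orthonormal expansion), Ch. 3, pp. 60–61.
Everything is proved; no definition of `Prop` type.

## References

* P. Topping, *Lectures on the Ricci flow*, LMS Lecture Note Series 325, CUP 2006, §2.1, §3.2
  (p. 37), §3.3. [Topping2006]
* B. O'Neill, *Semi-Riemannian geometry with applications to relativity*, Academic Press 1983,
  Ch. 2, Lemma 2.25–2.31; Ch. 3, pp. 60–61. [ONeill1983]
-/

noncomputable section

set_option maxSynthPendingDepth 3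

open Set Filter ContinuousLinearMap Module Function
open scoped Topology ContDiff

namespace Literature.Geometry.Lorentzian

namespace MetricCoord

variable {E : Type*} [NormedAddCommGroup E] [NormedSpace ℝ E] {ι : Type*}

/-! ### Multilinear evaluation of component arrays -/

section FrameComp

variable [Fintype ι] (b : Basis ι ℝ E) {α : Type*} [Fintype α] [DecidableEq α]

/-- **Multilinear evaluation of a component array**: `T(v) = Σ_I (Π_a bᴵᵃ(v_a)) T_I` for
`T₀ = (T_I)` and vectors `v : α → E`. [cite: ONeill1983, Ch. 2, Lemma 2.3 ff.] -/
def frameComp (T₀ : (α → ι) → ℝ) (v : α → E) : ℝ :=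
  ∑ I : α → ι, (∏ a, b.coord (I a) (v a)) * T₀ I

/-- Unfolding lemma for `frameComp`. [cite: ONeill1983, Ch. 2, Lemma 2.3 ff.] -/
theorem frameComp_apply (T₀ : (α → ι) → ℝ) (v : α → E) :
    frameComp b T₀ v = ∑ I : α → ι, (∏ a, b.coord (I a) (v a)) * T₀ I := rfl

/-- On basis vectors the evaluation returns the component: `T(b ∘ I) = T_I`. [folklore] -/
theorem frameComp_basis [DecidableEq ι] (T₀ : (α → ι) → ℝ) (I : α → ι) :
    frameComp b T₀ (b ∘ I) = T₀ I := by
  rw [frameComp_apply]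
  have h : ∀ J : α → ι, (∏ a, b.coord (J a) ((b ∘ I) a)) = if I = J then 1 else 0 := by
    intro J
    simp only [Function.comp_apply, Basis.coord_apply, Basis.repr_self, Finsupp.single_apply]
    rw [Finset.prod_boole]
    simp [funext_iff]
  simp only [h, ite_mul, one_mul, zero_mul, Finset.sum_ite_eq, Finset.mem_univ, if_true]

/-- **Multilinear expansion**: `T(Σ_c w_{a c} e_c)_a = Σ_K (Π_a w_{a K_a}) T(e_K)`. [cite: ONeill1983, Ch. 2, Lemma 2.3 ff.] -/
theorem frameComp_sum_smul {κ : Type*} [Fintype κ] [DecidableEq κ] (T₀ : (α → ι) → ℝ)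
    (w : α → κ → ℝ) (e : κ → E) :
    frameComp b T₀ (fun a ↦ ∑ c, w a c • e c) = ∑ K : α → κ, (∏ a, w a (K a)) * frameComp b T₀ (e ∘ K) := by
  have hP : ∀ J : α → ι, (∏ a, ∑ c, w a c * b.coord (J a) (e c)) =
      ∑ K : α → κ, (∏ a, w a (K a)) * ∏ a, b.coord (J a) (e (K a)) := by
    intro J
    rw [Finset.prod_univ_sum (fun _ ↦ Finset.univ) (fun a c ↦ w a c * b.coord (J a) (e c)),
      Fintype.piFinset_univ]
    exact Finset.sum_congr rfl fun K _ ↦ Finset.prod_mul_distrib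
  simp only [frameComp_apply, map_sum, map_smul, smul_eq_mul, Function.comp_apply, hP, Finset.sum_mul,
    Finset.mul_sum]
  rw [Finset.sum_comm]
  exact Finset.sum_congr rfl fun K _ ↦ Finset.sum_congr rfl fun J _ ↦ by ring

/-- Sums over index functions on `Option α`. [folklore] -/
theorem sum_optionIndex {R : Type*} [AddCommMonoid R] (F : (Option α → ι) → R) :
    ∑ K : Option α → ι, F K = ∑ k, ∑ I : α → ι, F (ocons k I) := by
  rw [← (Equiv.piOptionEquivProd (β := fun _ ↦ ι)).symm.sum_comp, Fintype.sum_prod_type]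
  refine Finset.sum_congr rfl fun k _ ↦ Finset.sum_congr rfl fun I _ ↦ ?_
  congr 1
  funext o; cases o <;> rfl

end FrameComp

/-! ### Orthonormal frames -/

section Ortho

variable [Fintype ι] {G : E → E →L[ℝ] E →L[ℝ] ℝ} (b : Basis ι ℝ E) {x : E}
  {κ : Type*} [Fintype κ] [DecidableEq κ] (e : Basis κ ℝ E)
  (he : ∀ c d, G x (e c) (e d) = if c = d then 1 else 0)
include he

omit [Fintype ι] in
/-- **`♯` in an orthonormal frame**: `♯φ = Σ_c φ(e_c) e_c`. [cite: ONeill1983, Ch. 2, Lemma 2.25] -/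
theorem sharpAt_eq_sum_frame (hi : (G x).IsInvertible) (hs : ∀ v w, G x v w = G x w v) (φ : E →L[ℝ] ℝ) :
    sharpAt G x φ = ∑ c, φ (e c) • e c := by
  refine sharpAt_eq_of_forall hi fun w ↦ ?_
  conv_rhs => rw [← sum_apply_smul_of_orthonormal e he w]
  rw [map_sum, map_sum, _root_.sum_apply]
  refine Finset.sum_congr rfl fun c _ ↦ ?_
  rw [map_smul, map_smul, _root_.smul_apply, smul_eq_mul, smul_eq_mul, hs (e c) w, mul_comm]

variable [FiniteDimensional ℝ E]

omit [Fintype ι] in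
/-- **The inverse metric in an orthonormal frame**: `g^{ij} = Σ_c bⁱ(e_c) bʲ(e_c)`.
[cite: ONeill1983, Ch. 3, p. 60] -/
theorem ginv_eq_sum_coord_frame (hi : (G x).IsInvertible) (hs : ∀ v w, G x v w = G x w v) (i j : ι) :
    ginv G b x i j = ∑ c, b.coord i (e c) * b.coord j (e c) := by
  unfold ginv
  rw [sharpAt_eq_sum_frame e he hi hs, map_sum]
  refine Finset.sum_congr rfl fun c _ ↦ ?_
  rw [map_smul, smul_eq_mul, coordCLM_apply, mul_comm]

variable {α : Type*} [Fintype α] [DecidableEq α]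

/-- **Parseval for the full contraction**: `⟨S, T⟩_g = Σ_K S(e_K) T(e_K)` over multi-indices `K`
in a `G x`-orthonormal frame. [cite: ONeill1983, Ch. 2, Lemma 2.25 ff.] -/
theorem tinner_eq_sum_frame (hi : (G x).IsInvertible) (hs : ∀ v w, G x v w = G x w v)
    (S T : E → (α → ι) → ℝ) :
    tinner G b S T x = ∑ K : α → κ, frameComp b (S x) (e ∘ K) * frameComp b (T x) (e ∘ K) := by
  have hP : ∀ I J : α → ι, (∏ a, ginv G b x (I a) (J a)) =
      ∑ K : α → κ, (∏ a, b.coord (I a) (e (K a))) * ∏ a, b.coord (J a) (e (K a)) := by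
    intro I J
    simp only [ginv_eq_sum_coord_frame b e he hi hs]
    rw [Finset.prod_univ_sum (fun _ ↦ Finset.univ) (fun a c ↦ b.coord (I a) (e c) * b.coord (J a) (e c)),
      Fintype.piFinset_univ]
    exact Finset.sum_congr rfl fun K _ ↦ Finset.prod_mul_distrib
  rw [tinner_apply]
  simp only [hP, Finset.sum_mul]
  rw [sum_comm₃' fun (I J : α → ι) (K : α → κ) ↦
    (∏ a, b.coord (I a) (e (K a))) * (∏ a, b.coord (J a) (e (K a))) * (S x I * T x J)]
  refine Finset.sum_congr rfl fun K _ ↦ ?_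
  rw [frameComp_apply, frameComp_apply, Finset.sum_mul_sum]
  refine Finset.sum_congr rfl fun I _ ↦ Finset.sum_congr rfl fun J _ ↦ ?_
  simp only [Function.comp_apply]
  ring

/-- **Parseval for `|T|²`**: `|T|²_g = Σ_K T(e_K)²`. [cite: Topping2006, §3.2, p. 37] -/
theorem tnormSq_eq_sum_sq_frame (hi : (G x).IsInvertible) (hs : ∀ v w, G x v w = G x w v)
    (T : E → (α → ι) → ℝ) :
    tnormSq G b T x = ∑ K : α → κ, frameComp b (T x) (e ∘ K) ^ 2 := by
  rw [tnormSq_eq, tinner_eq_sum_frame b e he hi hs]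
  exact Finset.sum_congr rfl fun K _ ↦ by ring

/-- A frame component is at most the norm: `|T(e_K)| ≤ |T|`. [cite: Topping2006, §3.2, p. 37] -/
theorem abs_frameComp_le_sqrt (hi : (G x).IsInvertible) (hs : ∀ v w, G x v w = G x w v)
    (T : E → (α → ι) → ℝ) (K : α → κ) :
    |frameComp b (T x) (e ∘ K)| ≤ Real.sqrt (tnormSq G b T x) := by
  apply Real.abs_le_sqrt
  rw [tnormSq_eq_sum_sq_frame b e he hi hs]
  exact Finset.single_le_sum (f := fun K ↦ frameComp b (T x) (e ∘ K) ^ 2) (fun K _ ↦ sq_nonneg _)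
    (Finset.mem_univ K)

/-- **The trace in an orthonormal frame**: `(tr T)(e_K) = Σ_c T(e_c, e_c, e_K)`.
[cite: ONeill1983, Ch. 3, p. 60] -/
theorem frameComp_ttr (hi : (G x).IsInvertible) (hs : ∀ v w, G x v w = G x w v)
    (T : E → (Option (Option α) → ι) → ℝ) (K : α → κ) :
    frameComp b (ttr G b T x) (e ∘ K) = ∑ c, frameComp b (T x) (e ∘ ocons c (ocons c K)) := by
  -- both sides equal the normal form `Σ_j Σ_k Σ_I Σ_c bʲ(e_c) bᵏ(e_c) (Π_a b^{I_a}(e_{K_a})) T_{jkI}`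
  have hL : frameComp b (ttr G b T x) (e ∘ K) = ∑ j, ∑ k, ∑ I : α → ι, ∑ c,
      (∏ a, b.coord (I a) (e (K a))) * (b.coord j (e c) * b.coord k (e c)) * T x (ocons j (ocons k I)) := by
    rw [frameComp_apply]
    simp only [ttr_apply, Finset.mul_sum, Function.comp_apply]
    rw [← sum_comm₃' fun (j k : ι) (I : α → ι) ↦
      (∏ a, b.coord (I a) (e (K a))) * (ginv G b x j k * T x (ocons j (ocons k I)))]
    refine Finset.sum_congr rfl fun j _ ↦ Finset.sum_congr rfl fun k _ ↦
      Finset.sum_congr rfl fun I _ ↦ ?_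
    rw [ginv_eq_sum_coord_frame b e he hi hs, Finset.sum_mul, Finset.mul_sum]
    exact Finset.sum_congr rfl fun c _ ↦ by ring
  have hR : ∑ c, frameComp b (T x) (e ∘ ocons c (ocons c K)) = ∑ j, ∑ k, ∑ I : α → ι, ∑ c,
      (∏ a, b.coord (I a) (e (K a))) * (b.coord j (e c) * b.coord k (e c)) * T x (ocons j (ocons k I)) := by
    simp only [frameComp_apply, sum_optionIndex, Fintype.prod_option, Function.comp_apply, ocons_none,
      ocons_some]
    conv_lhs => rw [Finset.sum_comm]
    refine Finset.sum_congr rfl fun j _ ↦ ?_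
    conv_lhs => rw [Finset.sum_comm]
    refine Finset.sum_congr rfl fun k _ ↦ ?_
    conv_lhs => rw [Finset.sum_comm]
    exact Finset.sum_congr rfl fun I _ ↦ Finset.sum_congr rfl fun c _ ↦ by ring
  rw [hL, hR]

end Ortho

/-! ### Consequences at positive definite points -/

section PosDef

variable [Fintype ι] {G : E → E →L[ℝ] E →L[ℝ] ℝ} (b : Basis ι ℝ E) {x : E} [FiniteDimensional ℝ E]
  (hs : ∀ v w, G x v w = G x w v) (hpos : ∀ v, v ≠ 0 → 0 < G x v v)
  {α : Type*} [Fintype α] [DecidableEq α]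
include hs hpos

omit [Fintype ι] hs in
/-- A positive definite `G x` is invertible. [folklore] -/
theorem isInvertible_of_pos : (G x).IsInvertible :=
  isInvertible_of_nondegenerate fun v hv ↦ by
    by_contra hne
    exact (hpos v hne).ne' (hv v)

/-- **`|T|² ≥ 0`** at positive definite points. [cite: Topping2006, §3.2, p. 37] -/
theorem tnormSq_nonneg (T : E → (α → ι) → ℝ) : 0 ≤ tnormSq G b T x := by
  obtain ⟨e, he⟩ := exists_orthonormal_basis hs hpos
  rw [tnormSq_eq_sum_sq_frame b e he (isInvertible_of_pos hpos) hs]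
  exact Finset.sum_nonneg fun K _ ↦ sq_nonneg _

/-- **Cauchy–Schwarz**: `|⟨S, T⟩| ≤ |S| |T|`. [cite: Topping2006, §3.2, p. 37] -/
theorem abs_tinner_le (S T : E → (α → ι) → ℝ) :
    |tinner G b S T x| ≤ Real.sqrt (tnormSq G b S x) * Real.sqrt (tnormSq G b T x) := by
  obtain ⟨e, he⟩ := exists_orthonormal_basis hs hpos
  have hi := isInvertible_of_pos hpos
  rw [tinner_eq_sum_frame b e he hi hs, tnormSq_eq_sum_sq_frame b e he hi hs,
    tnormSq_eq_sum_sq_frame b e he hi hs, ← Real.sqrt_mul (Finset.sum_nonneg fun K _ ↦ sq_nonneg _),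
    ← Real.sqrt_sq_eq_abs]
  exact Real.sqrt_le_sqrt (Finset.sum_mul_sq_le_sq_mul_sq _ _ _)

/-- `|S + T| ≤ |S| + |T|`. [folklore] -/
theorem sqrt_tnormSq_add_le (S T : E → (α → ι) → ℝ) :
    Real.sqrt (tnormSq G b (S + T) x) ≤ Real.sqrt (tnormSq G b S x) + Real.sqrt (tnormSq G b T x) := by
  have hS := tnormSq_nonneg b hs hpos S
  have hT := tnormSq_nonneg b hs hpos T
  have hCS := abs_tinner_le b hs hpos S T
  rw [Real.sqrt_le_left (by positivity)]
  have hexp : tnormSq G b (S + T) x = tnormSq G b S x + 2 * tinner G b S T x + tnormSq G b T x := by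
    have hgs : ∀ i j, ginv G b x i j = ginv G b x j i :=
      fun i j ↦ ginv_comm b (isInvertible_of_pos hpos) hs i j
    simp only [tnormSq_eq, tinner_add_left, tinner_add_right, tinner_comm hgs T S]
    ring
  rw [hexp, add_sq, Real.sq_sqrt hS, Real.sq_sqrt hT]
  nlinarith [abs_le.mp hCS]

omit hs hpos in
/-- `|c T|² = c² |T|²`. [folklore] -/
theorem tnormSq_smul (c : ℝ) (T : E → (α → ι) → ℝ) : tnormSq G b (c • T) x = c ^ 2 * tnormSq G b T x := by
  simp only [tnormSq_eq, tinner_smul_left, tinner_smul_right]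
  ring

omit hs hpos in
/-- `|-T|² = |T|²`. [folklore] -/
theorem tnormSq_neg (T : E → (α → ι) → ℝ) : tnormSq G b (-T) x = tnormSq G b T x := by
  simp only [tnormSq_eq, tinner_neg_left, tinner_neg_right, neg_neg]

/-- **`|tr T|² ≤ n |T|²`** (`n = dim E`; Cauchy–Schwarz on the diagonal of an orthonormal frame).
[cite: Topping2006, §2.1] -/
theorem tnormSq_ttr_le (T : E → (Option (Option α) → ι) → ℝ) :
    tnormSq G b (ttr G b T) x ≤ Fintype.card ι * tnormSq G b T x := by
  obtain ⟨e, he⟩ := exists_orthonormal_basis hs hpos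
  have hi := isInvertible_of_pos hpos
  have hn : Fintype.card (Fin (finrank ℝ E)) = Fintype.card ι := by
    rw [Fintype.card_fin, finrank_eq_card_basis b]
  rw [tnormSq_eq_sum_sq_frame b e he hi hs, tnormSq_eq_sum_sq_frame b e he hi hs]
  calc ∑ K : α → Fin (finrank ℝ E), frameComp b (ttr G b T x) (e ∘ K) ^ 2
      = ∑ K : α → Fin (finrank ℝ E), (∑ c, frameComp b (T x) (e ∘ ocons c (ocons c K))) ^ 2 :=
        Finset.sum_congr rfl fun K _ ↦ by rw [frameComp_ttr b e he hi hs]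
    _ ≤ ∑ K : α → Fin (finrank ℝ E), Fintype.card ι *
          ∑ c, frameComp b (T x) (e ∘ ocons c (ocons c K)) ^ 2 := by
        refine Finset.sum_le_sum fun K _ ↦ ?_
        have h := sq_sum_le_card_mul_sum_sq (s := Finset.univ)
          (f := fun c ↦ frameComp b (T x) (e ∘ ocons c (ocons c K)))
        rw [Finset.card_univ, hn] at h
        exact h
    _ = Fintype.card ι * ∑ c, ∑ K : α → Fin (finrank ℝ E),
          frameComp b (T x) (e ∘ ocons c (ocons c K)) ^ 2 := by
        rw [← Finset.mul_sum, Finset.sum_comm]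
    _ ≤ Fintype.card ι * ∑ K' : Option (Option α) → Fin (finrank ℝ E), frameComp b (T x) (e ∘ K') ^ 2 := by
        refine mul_le_mul_of_nonneg_left ?_ (Nat.cast_nonneg _)
        rw [sum_optionIndex]
        refine Finset.sum_le_sum fun c _ ↦ ?_
        rw [sum_optionIndex]
        exact Finset.single_le_sum (f := fun d ↦ ∑ K : α → Fin (finrank ℝ E),
          frameComp b (T x) (e ∘ ocons c (ocons d K)) ^ 2)
          (fun d _ ↦ Finset.sum_nonneg fun K _ ↦ sq_nonneg _) (Finset.mem_univ c)

/-- **Coordinate components against the norm**: `|T_I| ≤ (Π_a g_{I_a I_a})^{1/2} |T|`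
(expansion of `b_{I_a}` in an orthonormal frame and Cauchy–Schwarz). [cite: Topping2006, §3.2, p. 37] -/
theorem abs_apply_le_sqrt_prod_mul (T : E → (α → ι) → ℝ) (I : α → ι) :
    |T x I| ≤ Real.sqrt (∏ a, G x (b (I a)) (b (I a))) * Real.sqrt (tnormSq G b T x) := by
  classical
  obtain ⟨e, he⟩ := exists_orthonormal_basis hs hpos
  have hi := isInvertible_of_pos hpos
  -- expansion of `T_I = T(b ∘ I)` in the frame
  have hexp : T x I = ∑ K : α → Fin (finrank ℝ E), (∏ a, G x (b (I a)) (e (K a))) *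
      frameComp b (T x) (e ∘ K) := by
    rw [← frameComp_basis b (T x) I]
    have hb : (b ∘ I) = fun a ↦ ∑ c, G x (b (I a)) (e c) • e c := by
      funext a; exact (sum_apply_smul_of_orthonormal e he (b (I a))).symm
    rw [hb, frameComp_sum_smul]
  have hC : ∑ K : α → Fin (finrank ℝ E), (∏ a, G x (b (I a)) (e (K a))) ^ 2 = ∏ a, G x (b (I a)) (b (I a)) := by
    have h1 : ∀ a, G x (b (I a)) (b (I a)) = ∑ c, G x (b (I a)) (e c) ^ 2 := fun a ↦ by
      rw [apply_eq_sum_of_orthonormal e he hs]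
      exact Finset.sum_congr rfl fun c _ ↦ by ring
    simp only [h1, ← Finset.prod_pow]
    rw [Finset.prod_univ_sum (fun _ ↦ Finset.univ) (fun a c ↦ G x (b (I a)) (e c) ^ 2), Fintype.piFinset_univ]
  rw [hexp, tnormSq_eq_sum_sq_frame b e he hi hs, ← hC, ← Real.sqrt_mul (Finset.sum_nonneg fun K _ ↦ sq_nonneg _),
    ← Real.sqrt_sq_eq_abs]
  exact Real.sqrt_le_sqrt (Finset.sum_mul_sq_le_sq_mul_sq _ _ _)

end PosDef

/-! ### The curvature tensor: `|Rm|²` of this file is `rmNormSqAt` -/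

section Rm

variable [Fintype ι] {G : E → E →L[ℝ] E →L[ℝ] ℝ} (b : Basis ι ℝ E) {x : E} [FiniteDimensional ℝ E]

omit [FiniteDimensional ℝ E] in
/-- Sums over index functions on `Fin (n+1)` peel off the first index. [folklore] -/
theorem sum_finSuccIndex {n : ℕ} {R : Type*} [AddCommMonoid R] (F : (Fin (n + 1) → ι) → R) :
    ∑ I : Fin (n + 1) → ι, F I = ∑ i, ∑ I' : Fin n → ι, F (Fin.cons i I') := by
  rw [← (Fin.consEquiv fun _ ↦ ι).sum_comp, Fintype.sum_prod_type]
  rfl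

omit [FiniteDimensional ℝ E] in
/-- **The multilinear evaluation of the curvature components is the curvature tensor**:
`Σ_I (Π_a b^{I_a}(v_a)) R_{I₀I₁I₂I₃} = G(R(v₀,v₁)v₂, v₃)`. [cite: ONeill1983, Ch. 3, Lemma 3.35] -/
theorem frameComp_rm4 (v : Fin 4 → E) :
    frameComp b (rm4 G b x) v = G x (riemAt G x (v 0) (v 1) (v 2)) (v 3) := by
  have hexp : G x (riemAt G x (v 0) (v 1) (v 2)) (v 3) =
      ∑ i₃, b.repr (v 3) i₃ * ∑ i₂, b.repr (v 2) i₂ * ∑ i₁, b.repr (v 1) i₁ * ∑ i₀, b.repr (v 0) i₀ *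
        G x (riemAt G x (b i₀) (b i₁) (b i₂)) (b i₃) := by
    conv_lhs => rw [← b.sum_repr (v 0), ← b.sum_repr (v 1), ← b.sum_repr (v 2), ← b.sum_repr (v 3),
      ← riemCLM_apply]
    simp only [map_sum, map_smul, _root_.sum_apply, _root_.smul_apply, smul_eq_mul, riemCLM_apply,
      Finset.mul_sum]
  rw [hexp, frameComp_apply]
  simp only [sum_finSuccIndex, Fintype.sum_unique]
  have h4 : ∀ i₀ i₁ i₂ i₃ : ι, (∏ a, b.coord ((Fin.cons i₀ (Fin.cons i₁ (Fin.cons i₂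
      (Fin.cons i₃ (default : Fin 0 → ι)))) : Fin 4 → ι) a) (v a)) *
        rm4 G b x (Fin.cons i₀ (Fin.cons i₁ (Fin.cons i₂ (Fin.cons i₃ default)))) =
      b.repr (v 3) i₃ * (b.repr (v 2) i₂ * (b.repr (v 1) i₁ * (b.repr (v 0) i₀ *
        G x (riemAt G x (b i₀) (b i₁) (b i₂)) (b i₃)))) := by
    intro i₀ i₁ i₂ i₃
    rw [Fin.prod_univ_four]
    change b.repr (v 0) i₀ * b.repr (v 1) i₁ * b.repr (v 2) i₂ * b.repr (v 3) i₃ *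
      G x (riemAt G x (b i₀) (b i₁) (b i₂)) (b i₃) = _
    ring
  simp only [h4, Finset.mul_sum]
  -- reverse the order of the four sums
  calc ∑ i₀, ∑ i₁, ∑ i₂, ∑ i₃, b.repr (v 3) i₃ * (b.repr (v 2) i₂ * (b.repr (v 1) i₁ * (b.repr (v 0) i₀ *
          G x (riemAt G x (b i₀) (b i₁) (b i₂)) (b i₃))))
      = ∑ i₀, ∑ i₁, ∑ i₃, ∑ i₂, b.repr (v 3) i₃ * (b.repr (v 2) i₂ * (b.repr (v 1) i₁ * (b.repr (v 0) i₀ *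
          G x (riemAt G x (b i₀) (b i₁) (b i₂)) (b i₃)))) :=
        Finset.sum_congr rfl fun _ _ ↦ Finset.sum_congr rfl fun _ _ ↦ Finset.sum_comm
    _ = ∑ i₀, ∑ i₃, ∑ i₁, ∑ i₂, b.repr (v 3) i₃ * (b.repr (v 2) i₂ * (b.repr (v 1) i₁ * (b.repr (v 0) i₀ *
          G x (riemAt G x (b i₀) (b i₁) (b i₂)) (b i₃)))) :=
        Finset.sum_congr rfl fun _ _ ↦ Finset.sum_comm
    _ = ∑ i₃, ∑ i₀, ∑ i₁, ∑ i₂, b.repr (v 3) i₃ * (b.repr (v 2) i₂ * (b.repr (v 1) i₁ * (b.repr (v 0) i₀ *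
          G x (riemAt G x (b i₀) (b i₁) (b i₂)) (b i₃)))) := Finset.sum_comm
    _ = ∑ i₃, ∑ i₀, ∑ i₂, ∑ i₁, b.repr (v 3) i₃ * (b.repr (v 2) i₂ * (b.repr (v 1) i₁ * (b.repr (v 0) i₀ *
          G x (riemAt G x (b i₀) (b i₁) (b i₂)) (b i₃)))) :=
        Finset.sum_congr rfl fun _ _ ↦ Finset.sum_congr rfl fun _ _ ↦ Finset.sum_comm
    _ = ∑ i₃, ∑ i₂, ∑ i₀, ∑ i₁, b.repr (v 3) i₃ * (b.repr (v 2) i₂ * (b.repr (v 1) i₁ * (b.repr (v 0) i₀ *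
          G x (riemAt G x (b i₀) (b i₁) (b i₂)) (b i₃)))) :=
        Finset.sum_congr rfl fun _ _ ↦ Finset.sum_comm
    _ = ∑ i₃, ∑ i₂, ∑ i₁, ∑ i₀, b.repr (v 3) i₃ * (b.repr (v 2) i₂ * (b.repr (v 1) i₁ * (b.repr (v 0) i₀ *
          G x (riemAt G x (b i₀) (b i₁) (b i₂)) (b i₃)))) :=
        Finset.sum_congr rfl fun _ _ ↦ Finset.sum_congr rfl fun _ _ ↦ Finset.sum_comm

/-- **`|Rm|²` of the component calculus is `rmNormSqAt`** (both are `Σ_K R(e_K)²` in an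
orthonormal frame; `rmNormSqAt_eq_sum_sq`). [cite: Topping2006, §3.2, (3.2.4)] -/
theorem IsMetricOn.tnormSq_rm4_eq_rmNormSqAt [DecidableEq ι] [CompleteSpace E] {V : Set E}
    (hG : IsMetricOn G V) (hx : x ∈ V) (hpos : ∀ v, v ≠ 0 → 0 < G x v v) :
    tnormSq G b (rm4 G b) x = rmNormSqAt G x := by
  have hs := hG.symm x hx
  obtain ⟨e, he⟩ := exists_orthonormal_basis hs hpos
  rw [tnormSq_eq_sum_sq_frame b e he (hG.isInvertible x hx) hs, hG.rmNormSqAt_eq_sum_sq e he hx]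
  simp only [frameComp_rm4, Function.comp_apply, sum_finSuccIndex, Fintype.sum_unique]
  rfl

end Rm

end MetricCoord

end Literature.Geometry.Lorentzian

end
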